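import Summits.Ventures.CertifiedArithmetic.LowPrec.GemmThetaLawGenE2M3
import Summits.Ventures.CertifiedArithmetic.LowPrec.GemmThetaLawGenBinary32

/-!
# The E2M3×E2M3 law is a θ-certificate at every precision `p ≥ 12`; the binary32 envelope

HONEST FRAMING (venture CertifiedArithmetic / cell `pub-lowprec`, seat gemm, gen 13): certified
error envelopes and provably optimal rounding/accumulation schemes for low-precision formats under
stated cost models; every table by two implementations; no hardware or vendor claims.

`thetaCert_e2m3Law`: the kernel tables `lawCheck_e2m3` (46,348 classes), `contOK_e2m3`,
`succOK_e2m3`, `lam_bound_e2m3` read through the landed law-generic soundness theorem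
`LawData.lawCheck_cert` (`GemmThetaLawGenCert.lean`) give `ThetaCertificate φ Π S ψ θ ρ β_pair κ`
for EVERY accumulator format `φ` with `manBits ≥ 11` (`p ≥ 12`), `qexp φ ≤ -6`, `2^(manBits+14) ≤
maxRat φ`, for the product alphabet E2M3×E2M3 (grid `2^-6`) under sequential round-to-nearest-even
accumulation; `abs_dot_err_le_e2m3_Binary32` is the binary32 instance (`p = 24`) as a two-sided
all-`n` envelope via `ThetaCertificate.abs_err_le`, with every E2M3×E2M3 product a letter
(`mul_mem_PiL_e2m3`, kernel over all pairs of magnitudes through `PiL_of_magTest`). This is the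
SUP side of gemm.tex Thm t:thetap6 (E2M3 row) for every `p ≥ 12`; the attainment side and `p < 12`
remain the two-implementation finite case analysis (not kernel-checked).
-/

namespace Literature.ComputerArithmetic.FloatingPoint

namespace MiniFloat

open Finset

namespace ThetaLaw

/-- KERNEL FACT: continuity of the `ψ` tables of the E2M3×E2M3 law. [cell] -/
theorem contOK_e2m3 : e2m3Law.contOK = true := by decide

/-- KERNEL FACT: every successor-vertex class list of the E2M3×E2M3 law serves `T = 0`
(`LawData.succOK`, the supplement of `GemmThetaLawGenSucc.lean`). [cell] -/
theorem succOK_e2m3 : e2m3Law.succOK = true := by decide +kernel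

/-- KERNEL FACT: the letters of the E2M3×E2M3 law are at most `3600` grid units. [cell] -/
theorem lam_bound_e2m3 : ∀ z ∈ e2m3Law.lam, z.natAbs ≤ 3600 := by decide +kernel

/-- THE E2M3×E2M3 LAW IS A θ-CERTIFICATE AT EVERY PRECISION `p ≥ 12` (grid `2^-6`; exponent range
`qexp ≤ -6`, `2^(m+14) ≤ maxRat`): `θ = (5M + 8)/252 = (5·2^(p-3) + 2)/63`, `ρ = 63 / 2`, `β_pair
= 191 / 2`, `κ = 2^10/(24·2^m + 32)`. [cell; kernel tables + the landed soundness theorem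
`lawCheck_cert`] -/
theorem thetaCert_e2m3Law (φ : Format) (hm : 11 ≤ φ.manBits) (hq : φ.qexp ≤ -6)
    (hR : (2 : ℚ) ^ (φ.manBits + 14) ≤ φ.maxRat) :
    ThetaCertificate φ (e2m3Law.PiL 6) (e2m3Law.SL 6 φ) (e2m3Law.psiL 6 φ)
      (e2m3Law.thetaL φ.manBits) e2m3Law.rhoL e2m3Law.betaL
      (e2m3Law.kappaL φ.manBits) := by
  obtain ⟨h1, h2, h3, h4⟩ := pow_params (a := 10) (by omega : 10 + 1 ≤ φ.manBits)
  exact e2m3Law.lawCheck_cert lawCheck_e2m3 contOK_e2m3 succOK_e2m3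
    (K := 2 ^ (φ.manBits - 10)) h1 (by rw [show e2m3Law.M0 = 2 ^ 10 from rfl]; exact h2) h3 h4
    (fun h => absurd h (by decide)) (G := 6) (by exact_mod_cast hq) hR
    (lam_small (c := 12) (by norm_num) lam_bound_e2m3 (by omega))
    (show (0 : ℤ) < 5 * 2 ^ φ.manBits + 8 by positivity) (by decide) (by decide)
    (show (0 : ℤ) < 24 * 2 ^ φ.manBits + 32 by positivity)

/-- The quanta of E2M3 and E2M3 multiply to `2^-6`. [cite: RouhaniEtAl2023MX, Table 1] -/
theorem quantum_e2m3 : Format.E2M3.quantum * Format.E2M3.quantum = 1 / 2 ^ 6 := by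
  rw [Format.E2M3_maxRat.2]; norm_num

/-- EVERY `E2M3·E2M3` PRODUCT IS A LETTER of the E2M3×E2M3 law (grid `2^-6`). [cell, kernel: all
64·64 pairs of magnitudes in quanta against `0 :: X` through `PiL_of_magTest`] -/
theorem mul_mem_PiL_e2m3 (a : MiniFloat Format.E2M3) (b : MiniFloat Format.E2M3) :
    e2m3Law.PiL 6 (a.toRat * b.toRat) :=
  PiL_of_magTest _ _ quantum_e2m3 (by decide +kernel) a b

/-- binary32 satisfies the format hypotheses of `thetaCert_e2m3Law` (`manBits = 23`,
`qexp = -149 ≤ -6`, `2^37 ≤ maxRat`). [cite: IEEE7542019, Table 3.5] -/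
theorem Binary32_hyps_e2m3 : Format.Binary32.manBits = 23 ∧ Format.Binary32.qexp ≤ -6 ∧
    (2 : ℚ) ^ (Format.Binary32.manBits + 14) ≤ Format.Binary32.maxRat := by
  refine ⟨rfl, by decide, ?_⟩
  rw [Format.Binary32_maxRat.1, show Format.Binary32.manBits = 23 from rfl]
  norm_num

/-- THE LAW'S CONSTANTS AT `p = 24` (binary32): `θ`, `κ`, `ρ`, `β_pair`. [cell] -/
theorem lawConstants_e2m3_Binary32 :
    e2m3Law.thetaL 23 = 499322 / 3 ∧ e2m3Law.kappaL 23 = 32 / 6291457 ∧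
    e2m3Law.rhoL = 63 / 2 ∧ e2m3Law.betaL = 191 / 2 := by
  have hB : e2m3Law.Bj 10 = 24 := by decide
  have hS : e2m3Law.Sj 10 = 32 := by decide
  simp only [LawData.thetaL, LawData.kappaL, LawData.rhoL, LawData.betaL,
    show e2m3Law.kb = 10 from rfl, hB, hS, show e2m3Law.th1 = 5 from rfl,
    show e2m3Law.th0 = 8 from rfl, show e2m3Law.thD = 252 from rfl,
    show e2m3Law.rhoN = 63 from rfl, show e2m3Law.rhoD = 2 from rfl,
    show e2m3Law.betaN = 191 from rfl, show e2m3Law.betaD = 2 from rfl]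
  norm_num

/-- E2M3×E2M3 PRODUCTS INTO binary32, SEQUENTIAL RNE, EVERY `n = m + 1`: the two-sided all-`n`
envelope `|ŝ - Σ a_j b_j| ≤ (1 - θ/(m + θ(1 + max ρ β_pair + κ)))·Σ|a_j b_j|` with the law's
constants at `p = 24` (`lawConstants_e2m3_Binary32`). [cell, gemm.tex Thm t:thetap6 (E2M3 row) +
Prop. Θ(i)] -/
theorem abs_dot_err_le_e2m3_Binary32 (a : ℕ → MiniFloat Format.E2M3)
    (b : ℕ → MiniFloat Format.E2M3) (m : ℕ) :
    |(seqSum Format.Binary32 (fun j => (a j).toRat * (b j).toRat) m).toRat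
        - ∑ j ∈ range (m + 1), (a j).toRat * (b j).toRat|
      ≤ (1 - e2m3Law.thetaL 23 / (m + e2m3Law.thetaL 23 *
          (1 + (max e2m3Law.rhoL e2m3Law.betaL + e2m3Law.kappaL 23))))
          * ∑ j ∈ range (m + 1), |(a j).toRat * (b j).toRat| := by
  obtain ⟨h1, h2, h3⟩ := Binary32_hyps_e2m3
  have hc := thetaCert_e2m3Law Format.Binary32 (by rw [h1]; norm_num) h2 h3
  rw [h1] at hc
  exact hc.abs_err_le (fun q hq => PiL_neg _ _ hq) _ (fun j => mul_mem_PiL_e2m3 (a j) (b j)) m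

end ThetaLaw

end MiniFloat

end Literature.ComputerArithmetic.FloatingPoint
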